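import Summits.CriticalPhenomena.PercolationContinuityZ3.Theorems.PercNearOneGluingNoHeavyConstsMDLXJointMarker
import HarnessLib

/-!
# MDL(X)′ on the lattice generated by the two marker events (PAPER-2 track (ii): constants of the CSH family)

builds on p205010 (kernel theorem, internal audit signed; external expert review pending).  Support file (`--supports
stmt-CriticalPhenomena-4575`), seat `prim-consts-2` (gen 9); memo `run/shared/lean/prim/consts/FROM-prim-consts-2-g9-MDLXJOINT.md` §6.1.
No definitions, no named facts, no sorries.  Companion of `…ConstsMDLXJointMarker.lean` (`Consts.mdlxJoint_connIndicator`: the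
`Consts.MDLXJoint` inequality at `F = 1{s ↔ y}`).  Notation: `D = {s ↮ X}`, `𝒜 = {y ↮ {s}∪X}`, `W = {y ↔ z}`, `Z = {s ↔ z}`, `Y = {s ↔ y}`,
`t = μ(𝒜∩D)`, `tw = μ(𝒜∩D∩W)` (so `p' = tw/t`), `ν = μ(·|D)`.

* `Consts.swallow_reach_le` — `μ(𝒜∩D)·μ(D ∩ {y↔X} ∩ Z) ≤ μ(D ∩ {y↔X})·μ(𝒜∩D∩Z)`: the worlds in which `X`'s cluster swallows `y` reach `z`
  less (BHK Thm 1.4 with sets, `{s}` vs `X ∪ {y}`); the `R ≥ 0` of the marker theorem, exposed.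
* `Consts.mdlx_marker_reach_le` — **`ν(s↔z) ≥ p'·ν(s↔y)`**: `tw·μ(D∩Y) ≤ t·μ(D∩Z)` (from `mdlxJoint_connIndicator`).
* `Consts.mdlx_marker_notReach_le` — **`ν(s↮z) ≥ p'·ν(s↮y)`**: `tw·μ(D∖Y) ≤ t·μ(D∖Z)` (from `swallow_reach_le` and inclusions).
* `Consts.mdlxJoint_at_connIndicator_z`, `Consts.mdlxJoint_at_connUnion`, `Consts.mdlxJoint_at_connInter` — the `Consts.MDLXJoint` inequality at
  `F = 1{s↔z}`, `F = 1{s↔y} ∨ 1{s↔z}` (`max`), `F = 1{s↔y}·1{s↔z}`.  With `mdlxJoint_at_connIndicator` this covers the four non-trivial up-sets of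
  the lattice `{0,1}²` of the marker pair `(1{y∈C_s}, 1{z∈C_s})`; since the conjectured inequality is linear in `F` and every monotone function of the
  pair is a nonnegative combination of these indicators (plus a constant), **MDL(X)′ holds for every monotone functional of `C_s` that depends only on
  whether `y` and `z` belong to the cluster.**  (The general conjecture remains open; no fixed polynomial certificate in the van den Berg–Häggström–Kahn
  brackets exists for a general up-set — kit LP j152593/j152663, memo §6.)
[cite: VandenbergHaggstromKahn2005, Thm. 1.3 (p. 6), Thm. 1.4 (p. 7) with Remark 1 after Thm. 1.2 (p. 5); KozmaNitzan2024 §2.2 p. 5]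
-/

noncomputable section

namespace Summit.CriticalPhenomena.PercolationContinuityZ3.Theorems

open MeasureTheory Set Literature.Probability.LatticeModels Literature.Probability.Percolation
open scoped Classical

namespace Consts

variable {V : Type*} [Fintype V]

/-- **Swallowing `y` costs reach**: `μ(𝒜∩D) · μ(D ∩ {y ↔ X} ∩ {s↔z}) ≤ μ(D ∩ {y ↔ X}) · μ(𝒜∩D∩{s↔z})`, i.e.
`P(s↔z | s↮X, y↔X) ≤ P(s↔z | s, y, X mutually separated)`.  BHK Theorem 1.4 with sets for `{s}` repelled from `X ∪ {y}`
(`{s↔z}` increasing in `C_s`, `{y↔X}` increasing in `C_{X∪{y}}`). [cite: VandenbergHaggstromKahn2005, Thm. 1.4 (p. 7), Remark 1 (p. 5)] -/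
theorem swallow_reach_le (w : Sym2 V → unitInterval) (s y z : V) (X : Set V) :
    (prodBernoulli w).real ({ω : BondConfig V | ∀ x ∈ insert s X, ¬ (openGraph ω).Reachable y x} ∩
        {ω | ∀ x ∈ X, ¬ (openGraph ω).Reachable s x}) *
      (prodBernoulli w).real ({ω : BondConfig V | ∀ x ∈ X, ¬ (openGraph ω).Reachable s x} ∩
        {ω | ∃ x ∈ X, (openGraph ω).Reachable y x} ∩ openConn s z) ≤
    (prodBernoulli w).real ({ω : BondConfig V | ∀ x ∈ X, ¬ (openGraph ω).Reachable s x} ∩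
        {ω | ∃ x ∈ X, (openGraph ω).Reachable y x}) *
      (prodBernoulli w).real ({ω : BondConfig V | ∀ x ∈ insert s X, ¬ (openGraph ω).Reachable y x} ∩
        {ω | ∀ x ∈ X, ¬ (openGraph ω).Reachable s x} ∩ openConn s z) := by
  classical
  set μ := prodBernoulli w with hμ
  have hmeas : ∀ S : Set (BondConfig V), MeasurableSet S := fun _ => MeasurableSet.of_discrete
  set D : Set (BondConfig V) := {ω | ∀ x ∈ X, ¬ (openGraph ω).Reachable s x} with hD
  set A : Set (BondConfig V) := {ω | ∀ x ∈ insert s X, ¬ (openGraph ω).Reachable y x} with hA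
  set Zv : Set (BondConfig V) := openConn s z with hZv
  set Gy : Set (BondConfig V) := {ω | ∃ x ∈ X, (openGraph ω).Reachable y x} with hGy
  set E₂ : Set (BondConfig V) := {ω | ∀ a ∈ ({s} : Set V), ∀ x ∈ insert y X, ¬ (openGraph ω).Reachable a x} with hE₂
  set T : Set (BondConfig V) := A ∩ D with hT
  set G : Set (BondConfig V) := D ∩ Gy with hG
  have mA : ∀ ω, ω ∈ A ↔ ¬ (openGraph ω).Reachable y s ∧ ∀ x ∈ X, ¬ (openGraph ω).Reachable y x := by
    intro ω; simp only [hA, mem_setOf_eq, mem_insert_iff, forall_eq_or_imp]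
  have mE₂ : ∀ ω, ω ∈ E₂ ↔ ¬ (openGraph ω).Reachable s y ∧ ∀ x ∈ X, ¬ (openGraph ω).Reachable s x := by
    intro ω; simp only [hE₂, mem_setOf_eq, mem_singleton_iff, forall_eq, mem_insert_iff, forall_eq_or_imp]
  have mD : ∀ ω, ω ∈ D ↔ ∀ x ∈ X, ¬ (openGraph ω).Reachable s x := fun ω => Iff.rfl
  have mGy : ∀ ω, ω ∈ Gy ↔ ∃ x ∈ X, (openGraph ω).Reachable y x := fun ω => Iff.rfl
  -- BHK 1.4 with sets
  set G₂ : Set (Sym2 V) → ℝ := fun C => if ∃ x ∈ X, (openGraph C).Reachable y x then 1 else 0 with hG₂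
  have hG₂m : Monotone G₂ := by
    refine TripodExchange.predIndicator_monotone ?_
    rintro C C' hCC' ⟨x, hx, hr⟩
    exact ⟨x, hx, hr.mono (openGraph_mono hCC')⟩
  have hF₂ω : ∀ ω : BondConfig V, connIndicatorFn s z (⋃ a ∈ ({s} : Set V), openEdgeCluster ω a) = Zv.indicator 1 ω := by
    intro ω
    have : (⋃ a ∈ ({s} : Set V), openEdgeCluster ω a) = openEdgeCluster ω s := by ext e; simp
    rw [this, connIndicatorFn_openEdgeCluster]
  have hG₂ω : ∀ ω : BondConfig V, G₂ (⋃ t ∈ insert y X, openEdgeCluster ω t) = Gy.indicator 1 ω := by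
    intro ω
    have hiff : (∃ x ∈ X, (openGraph (⋃ t ∈ insert y X, openEdgeCluster ω t)).Reachable y x) ↔
        ∃ x ∈ X, (openGraph ω).Reachable y x := by
      constructor
      · rintro ⟨x, hx, hr⟩
        exact ⟨x, hx, (KNSep.reachable_iff_cluster ω (insert y X) (mem_insert y X) x).2 hr⟩
      · rintro ⟨x, hx, hr⟩
        exact ⟨x, hx, (KNSep.reachable_iff_cluster ω (insert y X) (mem_insert y X) x).1 hr⟩
    simp only [hG₂, hiff]
    exact TwoSetConditionalAssociation.predIndicator_eq_indicator (fun ω' => ∃ x ∈ X, (openGraph ω').Reachable y x) ω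
  have hR0 := BHK2006_twoSetConditionalAssociation.negCorrelation w ({s} : Set V) (insert y X) (connIndicatorFn s z) G₂
    (monotone_connIndicatorFn s z) hG₂m
  simp only [hF₂ω, hG₂ω] at hR0
  change μ.real E₂ * (∫ ω in E₂, Zv.indicator 1 ω * Gy.indicator 1 ω ∂μ) ≤
    (∫ ω in E₂, Zv.indicator 1 ω ∂μ) * ∫ ω in E₂, Gy.indicator 1 ω ∂μ at hR0
  rw [TripodExchange.setIntegral_indicator_one_eq, TripodExchange.setIntegral_indicator_one_eq,
    TripodExchange.setIntegral_indicator_mul_indicator_eq] at hR0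
  -- set identities: `E₂ = T ⊔ G`, `E₂ ∩ Gy = G`
  have sE₂ : E₂ = T ∪ G := by
    ext ω; simp only [mE₂, mem_union, hT, hG, mem_inter_iff, mA, mD, mGy]
    constructor
    · rintro ⟨hsy, hsX⟩
      by_cases hyx : ∃ x ∈ X, (openGraph ω).Reachable y x
      · exact Or.inr ⟨hsX, hyx⟩
      · simp only [not_exists, not_and] at hyx
        exact Or.inl ⟨⟨fun h => hsy h.symm, hyx⟩, hsX⟩
    · rintro (⟨⟨hys, -⟩, hsX⟩ | ⟨hsX, ⟨x, hx, hr⟩⟩)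
      · exact ⟨fun h => hys h.symm, hsX⟩
      · exact ⟨fun hsy => hsX x hx (hsy.trans hr), hsX⟩
  have dTG : Disjoint T G := by
    rw [Set.disjoint_left]
    rintro ω ⟨hA', -⟩ ⟨-, ⟨x, hx, hr⟩⟩
    exact ((mA ω).1 hA').2 x hx hr
  have sE₂G : E₂ ∩ Gy = G := by
    ext ω; simp only [mem_inter_iff, mE₂, hG, mD, mGy]
    constructor
    · rintro ⟨⟨-, hsX⟩, hyx⟩; exact ⟨hsX, hyx⟩
    · rintro ⟨hsX, ⟨x, hx, hr⟩⟩; exact ⟨⟨fun hsy => hsX x hx (hsy.trans hr), hsX⟩, ⟨x, hx, hr⟩⟩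
  have sE₂ZG : E₂ ∩ (Zv ∩ Gy) = G ∩ Zv := by
    rw [inter_comm Zv Gy, ← inter_assoc, sE₂G]
  have sE₂Z : E₂ ∩ Zv = T ∩ Zv ∪ G ∩ Zv := by rw [sE₂, union_inter_distrib_right]
  have dTGZ : Disjoint (T ∩ Zv) (G ∩ Zv) := dTG.mono inter_subset_left inter_subset_left
  rw [sE₂ZG, sE₂Z, sE₂G, sE₂, measureReal_union dTG (hmeas _), measureReal_union dTGZ (hmeas _)] at hR0
  change μ.real T * μ.real (G ∩ Zv) ≤ μ.real G * μ.real (T ∩ Zv)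
  have h0 : ∀ S : Set (BondConfig V), 0 ≤ μ.real S := fun _ => measureReal_nonneg
  nlinarith [hR0, h0 T, h0 G, h0 (T ∩ Zv), h0 (G ∩ Zv)]

/-- **`ν(s↔z) ≥ p'·ν(s↔y)`** under `ν = μ(·|s↮X)`, denominator-free: `μ(𝒜∩D∩W)·μ(D∩Y) ≤ μ(𝒜∩D)·μ(D∩Z)`.  From
`mdlxJoint_connIndicator`: `t[μ(D)μ(DYZ) − μ(DY)μ(DZ)] ≥ tw·μ(DY)μ(D∖Y)` and `μ(DYZ) ≤ μ(DY)` give `t·μ(DZ)·μ(D∖Y) ≥ tw·μ(DY)·μ(D∖Y)`;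
if `μ(D∖Y) = 0` then `tw ≤ t ≤ μ(D∖Y) = 0`. [cite: VandenbergHaggstromKahn2005, Thm. 1.3 (p. 6), Thm. 1.4 (p. 7) — corollary, derived here] -/
theorem mdlx_marker_reach_le (w : Sym2 V → unitInterval) (s y z : V) (X : Set V) :
    (prodBernoulli w).real ({ω : BondConfig V | ∀ x ∈ insert s X, ¬ (openGraph ω).Reachable y x} ∩
        {ω | ∀ x ∈ X, ¬ (openGraph ω).Reachable s x} ∩ openConn y z) *
      (prodBernoulli w).real ({ω : BondConfig V | ∀ x ∈ X, ¬ (openGraph ω).Reachable s x} ∩ openConn s y) ≤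
    (prodBernoulli w).real ({ω : BondConfig V | ∀ x ∈ insert s X, ¬ (openGraph ω).Reachable y x} ∩
        {ω | ∀ x ∈ X, ¬ (openGraph ω).Reachable s x}) *
      (prodBernoulli w).real ({ω : BondConfig V | ∀ x ∈ X, ¬ (openGraph ω).Reachable s x} ∩ openConn s z) := by
  classical
  set μ := prodBernoulli w with hμ
  set D : Set (BondConfig V) := {ω | ∀ x ∈ X, ¬ (openGraph ω).Reachable s x} with hD
  set A : Set (BondConfig V) := {ω | ∀ x ∈ insert s X, ¬ (openGraph ω).Reachable y x} with hA
  have hmeas : ∀ S : Set (BondConfig V), MeasurableSet S := fun _ => MeasurableSet.of_discrete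
  have key := mdlxJoint_connIndicator w s y z X
  change μ.real (A ∩ D ∩ openConn y z) * μ.real (D ∩ openConn s y) * μ.real (D ∩ (openConn s y)ᶜ) ≤
    μ.real (A ∩ D) * (μ.real D * μ.real (D ∩ openConn s y ∩ openConn s z) -
      μ.real (D ∩ openConn s y) * μ.real (D ∩ openConn s z)) at key
  change μ.real (A ∩ D ∩ openConn y z) * μ.real (D ∩ openConn s y) ≤ μ.real (A ∩ D) * μ.real (D ∩ openConn s z)
  have h0 : ∀ S : Set (BondConfig V), 0 ≤ μ.real S := fun _ => measureReal_nonneg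
  have hsplit : μ.real D = μ.real (D ∩ openConn s y) + μ.real (D ∩ (openConn s y)ᶜ) := by
    rw [← Set.sdiff_eq]
    exact (measureReal_inter_add_sdiff (μ := μ) (s := D) (hmeas (openConn s y))).symm
  have hYZ : μ.real (D ∩ openConn s y ∩ openConn s z) ≤ μ.real (D ∩ openConn s y) :=
    measureReal_mono inter_subset_left
  have hYZ' : μ.real (D ∩ openConn s y ∩ openConn s z) ≤ μ.real (D ∩ openConn s z) :=
    measureReal_mono fun ω hω => ⟨hω.1.1, hω.2⟩
  have hTW : μ.real (A ∩ D ∩ openConn y z) ≤ μ.real (A ∩ D) := measureReal_mono inter_subset_left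
  have hTN : μ.real (A ∩ D) ≤ μ.real (D ∩ (openConn s y)ᶜ) := by
    refine measureReal_mono fun ω hω => ⟨hω.2, fun hsy => ?_⟩
    have hys : ¬ (openGraph ω).Reachable y s := hω.1 s (mem_insert s X)
    exact hys (show (openGraph ω).Reachable s y from hsy).symm
  by_cases hN : μ.real (D ∩ (openConn s y)ᶜ) = 0
  · have h1 : μ.real (A ∩ D ∩ openConn y z) = 0 := le_antisymm (hTW.trans (hN ▸ hTN)) (h0 _)
    rw [h1, zero_mul]
    exact mul_nonneg (h0 _) (h0 _)
  · have hNpos : 0 < μ.real (D ∩ (openConn s y)ᶜ) := lt_of_le_of_ne (h0 _) (Ne.symm hN)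
    have h2 : μ.real D * μ.real (D ∩ openConn s y ∩ openConn s z) -
        μ.real (D ∩ openConn s y) * μ.real (D ∩ openConn s z) ≤
        μ.real (D ∩ openConn s z) * μ.real (D ∩ (openConn s y)ᶜ) := by
      rw [hsplit]; nlinarith [hYZ', h0 (D ∩ openConn s y), h0 (D ∩ (openConn s y)ᶜ), h0 (D ∩ openConn s z)]
    have h3 := key.trans (mul_le_mul_of_nonneg_left h2 (h0 _))
    have h4 : (μ.real (A ∩ D ∩ openConn y z) * μ.real (D ∩ openConn s y)) * μ.real (D ∩ (openConn s y)ᶜ) ≤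
        (μ.real (A ∩ D) * μ.real (D ∩ openConn s z)) * μ.real (D ∩ (openConn s y)ᶜ) := by nlinarith [h3]
    exact le_of_mul_le_mul_right h4 hNpos

/-- **`ν(s↮z) ≥ p'·ν(s↮y)`** under `ν = μ(·|s↮X)`, denominator-free: `μ(𝒜∩D∩W)·μ(D∖Y) ≤ μ(𝒜∩D)·μ(D∖Z)`.
With `T = 𝒜∩D`, `G = D∩{y↔X}`: `D∖Y = T ⊔ G`, `μ(D∖Z) ≥ μ(T∖(Z∪W)) ... `; precisely `t·μ(D∖Z) − tw·μ(D∖Y) ≥ t·[μ(T)−μ(T∩Z)−μ(T∩W)] +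
[t·μ(G) − t·μ(G∩Z) − tw·μ(G)] ≥ (t + μ(G))·μ(T ∖ (Z ∪ W)) ≥ 0`, using `swallow_reach_le` (`t·μ(G∩Z) ≤ μ(G)·μ(T∩Z)`) and `T∩Z∩W = ∅`.
[cite: VandenbergHaggstromKahn2005, Thm. 1.4 (p. 7), Remark 1 (p. 5) — corollary, derived here] -/
theorem mdlx_marker_notReach_le (w : Sym2 V → unitInterval) (s y z : V) (X : Set V) :
    (prodBernoulli w).real ({ω : BondConfig V | ∀ x ∈ insert s X, ¬ (openGraph ω).Reachable y x} ∩
        {ω | ∀ x ∈ X, ¬ (openGraph ω).Reachable s x} ∩ openConn y z) *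
      (prodBernoulli w).real ({ω : BondConfig V | ∀ x ∈ X, ¬ (openGraph ω).Reachable s x} ∩ (openConn s y)ᶜ) ≤
    (prodBernoulli w).real ({ω : BondConfig V | ∀ x ∈ insert s X, ¬ (openGraph ω).Reachable y x} ∩
        {ω | ∀ x ∈ X, ¬ (openGraph ω).Reachable s x}) *
      (prodBernoulli w).real ({ω : BondConfig V | ∀ x ∈ X, ¬ (openGraph ω).Reachable s x} ∩ (openConn s z)ᶜ) := by
  classical
  set μ := prodBernoulli w with hμ
  set D : Set (BondConfig V) := {ω | ∀ x ∈ X, ¬ (openGraph ω).Reachable s x} with hD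
  set A : Set (BondConfig V) := {ω | ∀ x ∈ insert s X, ¬ (openGraph ω).Reachable y x} with hA
  set Gy : Set (BondConfig V) := {ω | ∃ x ∈ X, (openGraph ω).Reachable y x} with hGy
  set Zv : Set (BondConfig V) := openConn s z with hZv
  set Wv : Set (BondConfig V) := openConn y z with hWv
  set Yv : Set (BondConfig V) := openConn s y with hYv
  set T : Set (BondConfig V) := A ∩ D with hT
  set G : Set (BondConfig V) := D ∩ Gy with hG
  have hmeas : ∀ S : Set (BondConfig V), MeasurableSet S := fun _ => MeasurableSet.of_discrete
  have h0 : ∀ S : Set (BondConfig V), 0 ≤ μ.real S := fun _ => measureReal_nonneg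
  have hR := swallow_reach_le w s y z X
  change μ.real T * μ.real (D ∩ Gy ∩ Zv) ≤ μ.real (D ∩ Gy) * μ.real (T ∩ Zv) at hR
  change μ.real (T ∩ Wv) * μ.real (D ∩ Yvᶜ) ≤ μ.real T * μ.real (D ∩ Zvᶜ)
  have mA : ∀ ω, ω ∈ A ↔ ¬ (openGraph ω).Reachable y s ∧ ∀ x ∈ X, ¬ (openGraph ω).Reachable y x := by
    intro ω; simp only [hA, mem_setOf_eq, mem_insert_iff, forall_eq_or_imp]
  -- `D ∖ Y = T ⊔ G`
  have sDN : D ∩ Yvᶜ = T ∪ G := by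
    ext ω; simp only [mem_inter_iff, mem_compl_iff, mem_union, hT, hG, mA, hYv, openConn, mem_setOf_eq, hGy]
    constructor
    · rintro ⟨hsX, hsy⟩
      by_cases hyx : ∃ x ∈ X, (openGraph ω).Reachable y x
      · exact Or.inr ⟨hsX, hyx⟩
      · simp only [not_exists, not_and] at hyx
        exact Or.inl ⟨⟨fun h => hsy h.symm, hyx⟩, hsX⟩
    · rintro (⟨⟨hys, -⟩, hsX⟩ | ⟨hsX, ⟨x, hx, hr⟩⟩)
      · exact ⟨hsX, fun h => hys h.symm⟩
      · exact ⟨hsX, fun hsy => hsX x hx (hsy.trans hr)⟩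
  have dTG : Disjoint T G := by
    rw [Set.disjoint_left]
    rintro ω ⟨hA', -⟩ ⟨-, ⟨x, hx, hr⟩⟩
    exact ((mA ω).1 hA').2 x hx hr
  have eDN : μ.real (D ∩ Yvᶜ) = μ.real T + μ.real G := by rw [sDN, measureReal_union dTG (hmeas _)]
  -- `μ(D ∖ Z) ≥ μ(T ∖ Z) + μ(G ∖ Z)` (in fact `D∖Z ⊇ (T ⊔ G) ∖ Z`)
  have eTZ : μ.real T = μ.real (T ∩ Zv) + μ.real (T ∩ Zvᶜ) := by
    rw [← Set.sdiff_eq]; exact (measureReal_inter_add_sdiff (μ := μ) (s := T) (hmeas Zv)).symm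
  have eGZ : μ.real G = μ.real (G ∩ Zv) + μ.real (G ∩ Zvᶜ) := by
    rw [← Set.sdiff_eq]; exact (measureReal_inter_add_sdiff (μ := μ) (s := G) (hmeas Zv)).symm
  have hsub : μ.real (T ∩ Zvᶜ) + μ.real (G ∩ Zvᶜ) ≤ μ.real (D ∩ Zvᶜ) := by
    rw [← measureReal_union (dTG.mono inter_subset_left inter_subset_left) (hmeas _), ← union_inter_distrib_right, ← sDN]
    exact measureReal_mono fun ω hω => ⟨hω.1.1, hω.2⟩
  -- `μ(T ∩ W) + μ(T ∩ Z) ≤ μ(T)` (disjoint on `T`: `y↔z ∧ s↔z ⇒ s↔y`)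
  have hTWZ : μ.real (T ∩ Wv) + μ.real (T ∩ Zv) ≤ μ.real T := by
    have hd : Disjoint (T ∩ Wv) (T ∩ Zv) := by
      rw [Set.disjoint_left]
      rintro ω ⟨hT', hyz⟩ ⟨-, hsz⟩
      have hys : ¬ (openGraph ω).Reachable y s := ((mA ω).1 hT'.1).1
      exact hys ((show (openGraph ω).Reachable y z from hyz).trans (show (openGraph ω).Reachable s z from hsz).symm)
    rw [← measureReal_union hd (hmeas _)]
    exact measureReal_mono (union_subset inter_subset_left inter_subset_left)
  rw [eDN]
  nlinarith [hR, hsub, hTWZ, eTZ, eGZ, h0 T, h0 G, h0 (T ∩ Wv), h0 (T ∩ Zv), h0 (G ∩ Zv), h0 (G ∩ Zvᶜ), h0 (T ∩ Zvᶜ),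
    mul_nonneg (h0 G) (sub_nonneg.2 hTWZ)]

/-- **MDL(X)′ at `F = 1{s ↔ z}`** (the `Consts.MDLXJoint` inequality with `F = connIndicatorFn s z`): reduces to
`mdlx_marker_reach_le` (`tw·μ(DY) ≤ t·μ(DZ)`) and `μ(DYZ) ≤ μ(DY)`. [cite: VandenbergHaggstromKahn2005, Thm. 1.3 (p. 6), Thm. 1.4 (p. 7)] -/
theorem mdlxJoint_at_connIndicator_z (w : Sym2 V → unitInterval) (s y z : V) (X : Set V) :
    (prodBernoulli w).real ({ω : BondConfig V | ∀ x ∈ insert s X, ¬ (openGraph ω).Reachable y x} ∩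
          {ω | ∀ x ∈ X, ¬ (openGraph ω).Reachable s x} ∩ openConn y z) *
        ((prodBernoulli w).real {ω : BondConfig V | ∀ x ∈ X, ¬ (openGraph ω).Reachable s x} *
            (∫ ω in {ω : BondConfig V | ∀ x ∈ X, ¬ (openGraph ω).Reachable s x} ∩ openConn s y,
              connIndicatorFn s z (openEdgeCluster ω s) ∂(prodBernoulli w)) -
          (∫ ω in {ω : BondConfig V | ∀ x ∈ X, ¬ (openGraph ω).Reachable s x},
              connIndicatorFn s z (openEdgeCluster ω s) ∂(prodBernoulli w)) *
            (prodBernoulli w).real ({ω : BondConfig V | ∀ x ∈ X, ¬ (openGraph ω).Reachable s x} ∩ openConn s y)) ≤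
      (prodBernoulli w).real ({ω : BondConfig V | ∀ x ∈ insert s X, ¬ (openGraph ω).Reachable y x} ∩
          {ω | ∀ x ∈ X, ¬ (openGraph ω).Reachable s x}) *
        ((prodBernoulli w).real {ω : BondConfig V | ∀ x ∈ X, ¬ (openGraph ω).Reachable s x} *
            (∫ ω in {ω : BondConfig V | ∀ x ∈ X, ¬ (openGraph ω).Reachable s x} ∩ openConn s z,
              connIndicatorFn s z (openEdgeCluster ω s) ∂(prodBernoulli w)) -
          (∫ ω in {ω : BondConfig V | ∀ x ∈ X, ¬ (openGraph ω).Reachable s x},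
              connIndicatorFn s z (openEdgeCluster ω s) ∂(prodBernoulli w)) *
            (prodBernoulli w).real ({ω : BondConfig V | ∀ x ∈ X, ¬ (openGraph ω).Reachable s x} ∩ openConn s z)) := by
  classical
  set μ := prodBernoulli w with hμ
  set D : Set (BondConfig V) := {ω | ∀ x ∈ X, ¬ (openGraph ω).Reachable s x} with hD
  set A : Set (BondConfig V) := {ω | ∀ x ∈ insert s X, ¬ (openGraph ω).Reachable y x} with hA
  have hmeas : ∀ S : Set (BondConfig V), MeasurableSet S := fun _ => MeasurableSet.of_discrete
  simp_rw [connIndicatorFn_openEdgeCluster]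
  rw [KNPreFKG.setIntegral_indicator_one_eq, KNPreFKG.setIntegral_indicator_one_eq,
    KNPreFKG.setIntegral_indicator_one_eq]
  have e2 : D ∩ openConn s z ∩ openConn s z = D ∩ openConn s z := by rw [inter_assoc, inter_self]
  rw [e2]
  have K1 := mdlx_marker_reach_le w s y z X
  change μ.real (A ∩ D ∩ openConn y z) * μ.real (D ∩ openConn s y) ≤ μ.real (A ∩ D) * μ.real (D ∩ openConn s z) at K1
  change μ.real (A ∩ D ∩ openConn y z) * (μ.real D * μ.real (D ∩ openConn s y ∩ openConn s z) -
      μ.real (D ∩ openConn s z) * μ.real (D ∩ openConn s y)) ≤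
    μ.real (A ∩ D) * (μ.real D * μ.real (D ∩ openConn s z) - μ.real (D ∩ openConn s z) * μ.real (D ∩ openConn s z))
  have h0 : ∀ S : Set (BondConfig V), 0 ≤ μ.real S := fun _ => measureReal_nonneg
  have hsplit : μ.real D = μ.real (D ∩ openConn s z) + μ.real (D ∩ (openConn s z)ᶜ) := by
    rw [← Set.sdiff_eq]; exact (measureReal_inter_add_sdiff (μ := μ) (s := D) (hmeas (openConn s z))).symm
  have hYZ : μ.real (D ∩ openConn s y ∩ openConn s z) ≤ μ.real (D ∩ openConn s y) := measureReal_mono inter_subset_left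
  rw [hsplit]
  have h5 : μ.real (A ∩ D ∩ openConn y z) * ((μ.real (D ∩ openConn s z) + μ.real (D ∩ (openConn s z)ᶜ)) *
      μ.real (D ∩ openConn s y ∩ openConn s z)) ≤
      μ.real (A ∩ D ∩ openConn y z) * ((μ.real (D ∩ openConn s z) + μ.real (D ∩ (openConn s z)ᶜ)) *
      μ.real (D ∩ openConn s y)) :=
    mul_le_mul_of_nonneg_left (mul_le_mul_of_nonneg_left hYZ (add_nonneg (h0 _) (h0 _))) (h0 _)
  have h6 : μ.real (A ∩ D ∩ openConn y z) * μ.real (D ∩ openConn s y) * μ.real (D ∩ (openConn s z)ᶜ) ≤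
      μ.real (A ∩ D) * μ.real (D ∩ openConn s z) * μ.real (D ∩ (openConn s z)ᶜ) :=
    mul_le_mul_of_nonneg_right K1 (h0 _)
  nlinarith [h5, h6, h0 (A ∩ D ∩ openConn y z), h0 (D ∩ openConn s z), h0 (D ∩ openConn s y)]

/-- **MDL(X)′ at `F = 1{s↔y ∨ s↔z}`** (`F = max (connIndicatorFn s y) (connIndicatorFn s z)`, monotone): the margin factors as
`μ(D ∖ (Y∪Z)) · [t·μ(DZ) − tw·μ(DY)] ≥ 0` by `mdlx_marker_reach_le`. [cite: VandenbergHaggstromKahn2005, Thm. 1.3 (p. 6), Thm. 1.4 (p. 7)] -/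
theorem mdlxJoint_at_connUnion (w : Sym2 V → unitInterval) (s y z : V) (X : Set V) :
    (prodBernoulli w).real ({ω : BondConfig V | ∀ x ∈ insert s X, ¬ (openGraph ω).Reachable y x} ∩
          {ω | ∀ x ∈ X, ¬ (openGraph ω).Reachable s x} ∩ openConn y z) *
        ((prodBernoulli w).real {ω : BondConfig V | ∀ x ∈ X, ¬ (openGraph ω).Reachable s x} *
            (∫ ω in {ω : BondConfig V | ∀ x ∈ X, ¬ (openGraph ω).Reachable s x} ∩ openConn s y,
              max (connIndicatorFn s y (openEdgeCluster ω s)) (connIndicatorFn s z (openEdgeCluster ω s)) ∂(prodBernoulli w)) -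
          (∫ ω in {ω : BondConfig V | ∀ x ∈ X, ¬ (openGraph ω).Reachable s x},
              max (connIndicatorFn s y (openEdgeCluster ω s)) (connIndicatorFn s z (openEdgeCluster ω s)) ∂(prodBernoulli w)) *
            (prodBernoulli w).real ({ω : BondConfig V | ∀ x ∈ X, ¬ (openGraph ω).Reachable s x} ∩ openConn s y)) ≤
      (prodBernoulli w).real ({ω : BondConfig V | ∀ x ∈ insert s X, ¬ (openGraph ω).Reachable y x} ∩
          {ω | ∀ x ∈ X, ¬ (openGraph ω).Reachable s x}) *
        ((prodBernoulli w).real {ω : BondConfig V | ∀ x ∈ X, ¬ (openGraph ω).Reachable s x} *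
            (∫ ω in {ω : BondConfig V | ∀ x ∈ X, ¬ (openGraph ω).Reachable s x} ∩ openConn s z,
              max (connIndicatorFn s y (openEdgeCluster ω s)) (connIndicatorFn s z (openEdgeCluster ω s)) ∂(prodBernoulli w)) -
          (∫ ω in {ω : BondConfig V | ∀ x ∈ X, ¬ (openGraph ω).Reachable s x},
              max (connIndicatorFn s y (openEdgeCluster ω s)) (connIndicatorFn s z (openEdgeCluster ω s)) ∂(prodBernoulli w)) *
            (prodBernoulli w).real ({ω : BondConfig V | ∀ x ∈ X, ¬ (openGraph ω).Reachable s x} ∩ openConn s z)) := by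
  classical
  set μ := prodBernoulli w with hμ
  set D : Set (BondConfig V) := {ω | ∀ x ∈ X, ¬ (openGraph ω).Reachable s x} with hD
  set A : Set (BondConfig V) := {ω | ∀ x ∈ insert s X, ¬ (openGraph ω).Reachable y x} with hA
  have hmeas : ∀ S : Set (BondConfig V), MeasurableSet S := fun _ => MeasurableSet.of_discrete
  have hmax : ∀ ω : BondConfig V, max (connIndicatorFn s y (openEdgeCluster ω s)) (connIndicatorFn s z (openEdgeCluster ω s)) =
      (openConn s y ∪ openConn s z).indicator 1 ω := by
    intro ω
    rw [connIndicatorFn_openEdgeCluster, connIndicatorFn_openEdgeCluster]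
    by_cases hy : ω ∈ openConn s y <;> by_cases hz : ω ∈ openConn s z <;>
      simp [indicator_of_mem, indicator_of_notMem, hy, hz, mem_union]
  simp_rw [hmax]
  rw [KNPreFKG.setIntegral_indicator_one_eq, KNPreFKG.setIntegral_indicator_one_eq,
    KNPreFKG.setIntegral_indicator_one_eq]
  have e1 : D ∩ openConn s y ∩ (openConn s y ∪ openConn s z) = D ∩ openConn s y := by
    rw [inter_assoc, inter_eq_left.2 (subset_union_left)]
  have e2 : D ∩ openConn s z ∩ (openConn s y ∪ openConn s z) = D ∩ openConn s z := by
    rw [inter_assoc, inter_eq_left.2 (subset_union_right)]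
  rw [e1, e2]
  have K1 := mdlx_marker_reach_le w s y z X
  change μ.real (A ∩ D ∩ openConn y z) * μ.real (D ∩ openConn s y) ≤ μ.real (A ∩ D) * μ.real (D ∩ openConn s z) at K1
  change μ.real (A ∩ D ∩ openConn y z) * (μ.real D * μ.real (D ∩ openConn s y) -
      μ.real (D ∩ (openConn s y ∪ openConn s z)) * μ.real (D ∩ openConn s y)) ≤
    μ.real (A ∩ D) * (μ.real D * μ.real (D ∩ openConn s z) -
      μ.real (D ∩ (openConn s y ∪ openConn s z)) * μ.real (D ∩ openConn s z))
  have h0 : ∀ S : Set (BondConfig V), 0 ≤ μ.real S := fun _ => measureReal_nonneg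
  have hV : μ.real (D ∩ (openConn s y ∪ openConn s z)) ≤ μ.real D := measureReal_mono inter_subset_left
  nlinarith [K1, hV, mul_le_mul_of_nonneg_right K1 (sub_nonneg.2 hV), h0 (A ∩ D), h0 (D ∩ openConn s z)]

/-- **MDL(X)′ at `F = 1{s↔y}·1{s↔z}`** (`F = connIndicatorFn s y · connIndicatorFn s z`, monotone): the margin factors as
`μ(D∩Y∩Z) · [t·μ(D∖Z) − tw·μ(D∖Y)] ≥ 0` by `mdlx_marker_notReach_le`. [cite: VandenbergHaggstromKahn2005, Thm. 1.4 (p. 7)] -/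
theorem mdlxJoint_at_connInter (w : Sym2 V → unitInterval) (s y z : V) (X : Set V) :
    (prodBernoulli w).real ({ω : BondConfig V | ∀ x ∈ insert s X, ¬ (openGraph ω).Reachable y x} ∩
          {ω | ∀ x ∈ X, ¬ (openGraph ω).Reachable s x} ∩ openConn y z) *
        ((prodBernoulli w).real {ω : BondConfig V | ∀ x ∈ X, ¬ (openGraph ω).Reachable s x} *
            (∫ ω in {ω : BondConfig V | ∀ x ∈ X, ¬ (openGraph ω).Reachable s x} ∩ openConn s y,
              connIndicatorFn s y (openEdgeCluster ω s) * connIndicatorFn s z (openEdgeCluster ω s) ∂(prodBernoulli w)) -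
          (∫ ω in {ω : BondConfig V | ∀ x ∈ X, ¬ (openGraph ω).Reachable s x},
              connIndicatorFn s y (openEdgeCluster ω s) * connIndicatorFn s z (openEdgeCluster ω s) ∂(prodBernoulli w)) *
            (prodBernoulli w).real ({ω : BondConfig V | ∀ x ∈ X, ¬ (openGraph ω).Reachable s x} ∩ openConn s y)) ≤
      (prodBernoulli w).real ({ω : BondConfig V | ∀ x ∈ insert s X, ¬ (openGraph ω).Reachable y x} ∩
          {ω | ∀ x ∈ X, ¬ (openGraph ω).Reachable s x}) *
        ((prodBernoulli w).real {ω : BondConfig V | ∀ x ∈ X, ¬ (openGraph ω).Reachable s x} *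
            (∫ ω in {ω : BondConfig V | ∀ x ∈ X, ¬ (openGraph ω).Reachable s x} ∩ openConn s z,
              connIndicatorFn s y (openEdgeCluster ω s) * connIndicatorFn s z (openEdgeCluster ω s) ∂(prodBernoulli w)) -
          (∫ ω in {ω : BondConfig V | ∀ x ∈ X, ¬ (openGraph ω).Reachable s x},
              connIndicatorFn s y (openEdgeCluster ω s) * connIndicatorFn s z (openEdgeCluster ω s) ∂(prodBernoulli w)) *
            (prodBernoulli w).real ({ω : BondConfig V | ∀ x ∈ X, ¬ (openGraph ω).Reachable s x} ∩ openConn s z)) := by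
  classical
  set μ := prodBernoulli w with hμ
  set D : Set (BondConfig V) := {ω | ∀ x ∈ X, ¬ (openGraph ω).Reachable s x} with hD
  set A : Set (BondConfig V) := {ω | ∀ x ∈ insert s X, ¬ (openGraph ω).Reachable y x} with hA
  have hmeas : ∀ S : Set (BondConfig V), MeasurableSet S := fun _ => MeasurableSet.of_discrete
  simp_rw [connIndicatorFn_openEdgeCluster]
  rw [TripodExchange.setIntegral_indicator_mul_indicator_eq, TripodExchange.setIntegral_indicator_mul_indicator_eq,
    TripodExchange.setIntegral_indicator_mul_indicator_eq]
  have e1 : D ∩ openConn s y ∩ (openConn s y ∩ openConn s z) = D ∩ (openConn s y ∩ openConn s z) := by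
    rw [inter_assoc, ← inter_assoc (openConn s y), inter_self]
  have e2 : D ∩ openConn s z ∩ (openConn s y ∩ openConn s z) = D ∩ (openConn s y ∩ openConn s z) := by
    rw [inter_assoc, inter_comm (openConn s y) (openConn s z), ← inter_assoc (openConn s z), inter_self, inter_comm (openConn s z)]
  rw [e1, e2]
  have K2 := mdlx_marker_notReach_le w s y z X
  change μ.real (A ∩ D ∩ openConn y z) * μ.real (D ∩ (openConn s y)ᶜ) ≤ μ.real (A ∩ D) * μ.real (D ∩ (openConn s z)ᶜ) at K2
  change μ.real (A ∩ D ∩ openConn y z) * (μ.real D * μ.real (D ∩ (openConn s y ∩ openConn s z)) -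
      μ.real (D ∩ (openConn s y ∩ openConn s z)) * μ.real (D ∩ openConn s y)) ≤
    μ.real (A ∩ D) * (μ.real D * μ.real (D ∩ (openConn s y ∩ openConn s z)) -
      μ.real (D ∩ (openConn s y ∩ openConn s z)) * μ.real (D ∩ openConn s z))
  have h0 : ∀ S : Set (BondConfig V), 0 ≤ μ.real S := fun _ => measureReal_nonneg
  have hsY : μ.real D = μ.real (D ∩ openConn s y) + μ.real (D ∩ (openConn s y)ᶜ) := by
    rw [← Set.sdiff_eq]; exact (measureReal_inter_add_sdiff (μ := μ) (s := D) (hmeas (openConn s y))).symm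
  have hsZ : μ.real D = μ.real (D ∩ openConn s z) + μ.real (D ∩ (openConn s z)ᶜ) := by
    rw [← Set.sdiff_eq]; exact (measureReal_inter_add_sdiff (μ := μ) (s := D) (hmeas (openConn s z))).symm
  have eq1 : μ.real (A ∩ D ∩ openConn y z) * (μ.real D * μ.real (D ∩ (openConn s y ∩ openConn s z)) -
      μ.real (D ∩ (openConn s y ∩ openConn s z)) * μ.real (D ∩ openConn s y)) =
      μ.real (D ∩ (openConn s y ∩ openConn s z)) * (μ.real (A ∩ D ∩ openConn y z) * μ.real (D ∩ (openConn s y)ᶜ)) := by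
    rw [hsY]; ring
  have eq2 : μ.real (A ∩ D) * (μ.real D * μ.real (D ∩ (openConn s y ∩ openConn s z)) -
      μ.real (D ∩ (openConn s y ∩ openConn s z)) * μ.real (D ∩ openConn s z)) =
      μ.real (D ∩ (openConn s y ∩ openConn s z)) * (μ.real (A ∩ D) * μ.real (D ∩ (openConn s z)ᶜ)) := by
    rw [hsZ]; ring
  rw [eq1, eq2]
  exact mul_le_mul_of_nonneg_left K2 (h0 _)

end Consts

end Summit.CriticalPhenomena.PercolationContinuityZ3.Theorems

end
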